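import Mathlib

/-!
# Crux `OnePercentCertificate` (stmt-AtomisticToContinuum-11958), line `Sketch`: stub `stub_bernsteinTail_eq`

Closed form of the Bernstein tail piece of the split: for `r > 0`, `T ≥ 0`,
`∫₀ᵀ t² e^{−t r²} dt = (2/r⁶)(1 − e^{−T r²}(1 + T r² + (T r²)²/2))`.

Proof: with `c := r²`, the function `t ↦ −e^{−c t}(t²/c + 2t/c² + 2/c³)` is an antiderivative
of `t ↦ t² e^{−c t}`; apply the fundamental theorem of calculus and simplify.
-/

noncomputable section

namespace Summit.AtomisticToContinuum.Crystallization.Theorems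

/-- Antiderivative of `t ↦ t² e^{−t r²}` for `r ≠ 0`:
`d/dt [−e^{−t r²}(t²/r² + 2t/r⁴ + 2/r⁶)] = t² e^{−t r²}`. -/
private lemma hasDerivAt_bernsteinTail_prim {r : ℝ} (hr : r ≠ 0) (t : ℝ) :
    HasDerivAt (fun t : ℝ => -Real.exp (-t * r ^ 2) * (t ^ 2 / r ^ 2 + 2 * t / r ^ 4 + 2 / r ^ 6))
      (t ^ 2 * Real.exp (-t * r ^ 2)) t := by
  have h1 : HasDerivAt (fun t : ℝ => -t * r ^ 2) (-1 * r ^ 2) t :=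
    (hasDerivAt_neg t).mul_const (r ^ 2)
  have h2 : HasDerivAt (fun t : ℝ => Real.exp (-t * r ^ 2))
      (Real.exp (-t * r ^ 2) * (-1 * r ^ 2)) t := h1.exp
  have ha : HasDerivAt (fun t : ℝ => t ^ 2 / r ^ 2) (((2 : ℕ) : ℝ) * t ^ (2 - 1) / r ^ 2) t :=
    (hasDerivAt_pow 2 t).div_const (r ^ 2)
  have hb : HasDerivAt (fun t : ℝ => 2 * t / r ^ 4) (2 * 1 / r ^ 4) t :=
    ((hasDerivAt_id t).const_mul 2).div_const (r ^ 4)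
  have hc : HasDerivAt (fun _ : ℝ => (2 : ℝ) / r ^ 6) 0 t := hasDerivAt_const t _
  refine (h2.fun_neg.fun_mul ((ha.fun_add hb).fun_add hc)).congr_deriv ?_
  push_cast
  field_simp
  ring

/-- STUB `stub_bernsteinTail_eq` of line `Sketch` (crux stmt-AtomisticToContinuum-11958): for `r > 0`
and `T ≥ 0`, `∫₀ᵀ t² e^{−t r²} dt = (2/r⁶)(1 − e^{−T r²}(1 + T r² + (T r²)²/2))`. [folklore] -/
theorem stub_bernsteinTail_eq (T r : ℝ) (hT : 0 ≤ T) (hr : 0 < r) : ∫ t in (0 : ℝ)..T, t ^ 2 * Real.exp (-t * r ^ 2) = 2 / r ^ 6 * (1 - Real.exp (-T * r ^ 2) * (1 + T * r ^ 2 + (T * r ^ 2) ^ 2 / 2)) := by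
  have _ := hT
  have hr0 : r ≠ 0 := hr.ne'
  have hint : IntervalIntegrable (fun t : ℝ => t ^ 2 * Real.exp (-t * r ^ 2))
      MeasureTheory.volume 0 T :=
    (by fun_prop : Continuous fun t : ℝ => t ^ 2 * Real.exp (-t * r ^ 2)).intervalIntegrable 0 T
  rw [intervalIntegral.integral_eq_sub_of_hasDerivAt
    (fun t _ => hasDerivAt_bernsteinTail_prim hr0 t) hint]
  have h0 : Real.exp (-(0 : ℝ) * r ^ 2) = 1 := by simp
  rw [h0]
  generalize Real.exp (-T * r ^ 2) = E
  field_simp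
  ring

end Summit.AtomisticToContinuum.Crystallization.Theorems
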